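import Literature.ModelTheory.PseudofiniteFields.DefinablePredicates
import Mathlib.LinearAlgebra.Matrix.Determinant.Basic
import HarnessLib

/-!
# Determinants of matrices of ring terms are ring terms

Topic `Literature/ModelTheory/PseudofiniteFields`.  Continuation of the `section Terms` of
`DefinablePredicates.lean` (iterated sums, products and powers of terms of the language of rings,
uniformly in the field): integer constants are closed ring terms (`exists_term_realize_natCast`,
`exists_term_realize_intCast`), and the DETERMINANT of a square matrix of ring terms is a ring
term (`exists_term_realize_det`): expand by the Leibniz formula
`det M = Σ_σ sign σ · ∏_i M_{σ i, i}` (`Matrix.det_apply'`) and assemble the term from the closed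
terms `±1` for the signs (`exists_term_realize_intCast`), the products
(`exists_term_realize_prod`) and the outer sum (`exists_term_realize_sum`).

This is the routine step "the Jacobian determinant of a tuple of generic polynomials is a
polynomial in the coefficients and the point, hence ONE ring term" by which smoothness / étaleness
conditions of bounded complexity become first-order, uniformly in the field
([ChatzidakisVanDenDriesMacintyre1992, §2], "by pure logic").  No property of the field `K`
beyond being a field (in `Type`, with a compatible ring structure) is used.

## References

* [ChatzidakisVanDenDriesMacintyre1992] Z. Chatzidakis, L. van den Dries, A. Macintyre, Definable
  sets over finite fields, J. reine angew. Math. 427 (1992) 107–135, §2.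

## Not here

Definability of the rank of a matrix of terms (all minors, immediate from this file and
`definable_termEq` / `definable_termNe`), adjugates and inverses.
-/

namespace Literature.ModelTheory.PseudofiniteFields

open FirstOrder FirstOrder.Language FirstOrder.Ring

section TermDeterminant

variable {α : Type}

/-- Natural-number constants are closed ring terms: some term realises `(n : K)` in every field.
[folklore] -/
theorem exists_term_realize_natCast (n : ℕ) :
    ∃ s : Language.ring.Term α, ∀ (K : Type) [Field K] [CompatibleRing K] (v : α → K),
      s.realize v = (n : K) := by
  induction n with
  | zero => exact ⟨0, fun K _ _ v => by rw [realize_zero, Nat.cast_zero]⟩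
  | succ n ih =>
    obtain ⟨s, hs⟩ := ih
    exact ⟨s + 1, fun K _ _ v => by rw [realize_add, realize_one, hs, Nat.cast_succ]⟩

/-- Integer constants are closed ring terms: some term realises `(n : K)` in every field.
[folklore] -/
theorem exists_term_realize_intCast (n : ℤ) :
    ∃ s : Language.ring.Term α, ∀ (K : Type) [Field K] [CompatibleRing K] (v : α → K),
      s.realize v = (n : K) := by
  obtain ⟨n, rfl | rfl⟩ := Int.eq_nat_or_neg n
  · obtain ⟨s, hs⟩ := exists_term_realize_natCast (α := α) n
    exact ⟨s, fun K _ _ v => by rw [hs, Int.cast_natCast]⟩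
  · obtain ⟨s, hs⟩ := exists_term_realize_natCast (α := α) n
    exact ⟨-s, fun K _ _ v => by rw [realize_neg, hs, Int.cast_neg, Int.cast_natCast]⟩

/-- **Determinants of matrices of ring terms are ring terms.**  For a square matrix `M` of terms
of the language of rings (rows and columns indexed by a finite type `ι`), some ring term realises,
in every field `K` and at every valuation `v`, the determinant of the matrix of the realisations
`((M i j).realize v)_{i j}`: the Leibniz expansion `Σ_σ sign σ · ∏_i M_{σ i, i}` written as a term.
[folklore] -/
theorem exists_term_realize_det {ι : Type} [Fintype ι] [DecidableEq ι]
    (M : ι → ι → Language.ring.Term α) :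
    ∃ s : Language.ring.Term α, ∀ (K : Type) [Field K] [CompatibleRing K] (v : α → K),
      s.realize v = (Matrix.of fun i j => (M i j).realize v).det := by
  choose sg hsg using fun σ : Equiv.Perm ι =>
    exists_term_realize_intCast (α := α) ((Equiv.Perm.sign σ : ℤˣ) : ℤ)
  choose pr hpr using fun σ : Equiv.Perm ι => exists_term_realize_prod (α := α) fun i => M (σ i) i
  obtain ⟨s, hs⟩ := exists_term_realize_sum fun σ : Equiv.Perm ι => sg σ * pr σ
  refine ⟨s, fun K _ _ v => ?_⟩
  rw [hs, Matrix.det_apply']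
  refine Finset.sum_congr rfl fun σ _ => ?_
  rw [realize_mul, hsg, hpr]
  simp only [Matrix.of_apply]

end TermDeterminant

end Literature.ModelTheory.PseudofiniteFields
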